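import Literature.Analysis.FluidPDE.NewtonPotentialHolder
import HarnessLib

/-!
# Derivatives of the near-field Newtonian kernel `Γ₀ = θΓ`: power bounds, values, supports

Analysis/FluidPDE support file on the discharge path of the named fact
`Literature.Analysis.FluidPDE.MajdaBertozzi2002_holderEulerLocalExistence`
(`ElgindiBlowupContinuationProofs.lean`, Lagrangian decomposition `HolderEulerLagrangian.lean`):
the Hölder-space potential theory of the Biot–Savart operator (Majda–Bertozzi, *Vorticity and
Incompressible Flow*, CUP 2002, §4.1.3 Lemmas 4.5–4.6, (4.38)–(4.39), p. 129 of the held text;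
Gilbarg–Trudinger 2001, Lemmas 4.2 and 4.4) is developed in the tree through the smooth
near/far splitting `Γ = Γ₀ + Γ∞` of the Newtonian kernel `Γ = −1/(4π|z|)`
(`NewtonKernel.lean`: `Γ₀ = newtonNear r₀ r₁ = θΓ` compactly supported and singular,
`Γ∞ = newtonFar r₀ r₁ = (1 − θ)Γ` smooth with bounded derivatives). This file is the
kernel-level calculus of the **near part** needed by the singular-integral estimates
(`HolderCZKernel.lean`, `NewtonNearCZ.lean`) and by the differentiation of the near potential:

* `exists_norm_le_mul_rpow_of_homogeneous`: a function continuous off the origin and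
  homogeneous of degree `m` satisfies `‖Φ z‖ ≤ M|z|^m` for `z ≠ 0`; whence
  `‖D²Γ(z)‖ ≤ M₂|z|⁻³`, `‖D³Γ(z)‖ ≤ M₃|z|⁻⁴` (`exists_norm_fderiv2_newtonKernel_le_rpow`,
  `exists_norm_fderiv3_newtonKernel_le_rpow`; `‖DΓ(z)‖ = (4π|z|²)⁻¹` is the tree's
  `norm_fderiv_newtonKernel`);
* the derivatives of `Γ₀` off the origin are those of `Γ` minus those of `Γ∞`
  (`fderiv_newtonNear_eq_sub`, `fderiv2_newtonNear_eq_sub`, `fderiv3_newtonNear_eq_sub`), agree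
  with those of `Γ` on `|z| < r₀` and vanish for `|z| > r₁`; at the origin the junk values are
  `DΓ₀(0) = 0`, `D²Γ₀(0) = 0` (`Γ₀`, `DΓ₀` are discontinuous there, hence not differentiable:
  `fderiv_newtonNear_zero`, `fderiv2_newtonNear_zero`);
* **power bounds** with constants depending on `r₀, r₁` only: `‖DΓ₀(z)‖ ≤ C₁|z|⁻²`,
  `‖D²Γ₀(z)‖ ≤ C₂|z|⁻³`, `‖D³Γ₀(z)‖ ≤ C₃|z|⁻⁴` for `z ≠ 0`
  (`exists_norm_fderiv_newtonNear_le`, `…fderiv2…`, `…fderiv3…`: on `0 < |z| ≤ r₁` add the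
  bounds for `Γ` and for `Γ∞`, the latter `≤ N ≤ N r₁ᵏ|z|⁻ᵏ`; beyond `r₁` everything vanishes);
* the kernels of the first two derivative potentials as everywhere-defined functions:
  `newtonNearGrad r₀ r₁ a z = DΓ₀(z) a` (`= ⟨z,a⟩/(4π|z|³)` for `0 < |z| < r₀`) and
  `newtonNearHess r₀ r₁ a b z = D²Γ₀(z)(b)(a) = ∂_b∂_aΓ₀(z)`, with measurability, the bounds
  `|newtonNearGrad a z| ≤ C₁‖a‖|z|⁻²`, `|newtonNearHess a b z| ≤ C₂‖a‖‖b‖|z|⁻³` for **all** `z`,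
  vanishing for `|z| ≥ r₁` (by continuity at `|z| = r₁`), compact support, smoothness off the
  origin, `fderiv (newtonNearGrad a) z b = newtonNearHess a b z` for `z ≠ 0`, and the
  integrability of `newtonNearGrad a` (`|z|⁻²` is locally integrable in `ℝ³`).

Everything is proved; the only definitions are the two kernel abbreviations.

## Mathlib / tree search

Tree (all used): `newtonKernel`, `norm_fderiv_newtonKernel`, `fderiv_newtonKernel_apply`,
`fderiv2_newtonKernel_homogeneous`, `fderiv3_newtonKernel_homogeneous`,
`contDiffOn_fderiv*_newtonKernel`, `newtonNear`, `newtonFar`, `newtonNear_eq_sub`,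
`newtonNear_eventuallyEq_newtonKernel`, `contDiffAt_newtonNear`, `contDiff_newtonFar`,
`newtonFar_eventuallyEq_zero`, `exists_bound_newtonFar_derivs`, `radialCutoff_eventuallyEq_zero`
(`NewtonKernel`); `integrableOn_ball_norm_rpow_neg` (`NewtonPotentialHolder`). Mathlib:
`Filter.EventuallyEq.fderiv_eq`, `fderiv_zero_of_not_differentiableAt`, `measurable_fderiv`,
`IsCompact.exists_bound_of_continuousOn`, `Real.rpow_intCast`.

## References

* A. J. Majda, A. L. Bertozzi, *Vorticity and Incompressible Flow* (CUP 2002), §4.1.3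
  (4.30)–(4.33) (homogeneity of `K_N`, `P_N = ∇K_N`), Lemmas 4.5–4.6, p. 129. [MajdaBertozziCUP2002]
* D. Gilbarg, N. S. Trudinger, *Elliptic Partial Differential Equations of Second Order*
  (2001), (2.12)–(2.14), Lemma 4.2 with the cutoff `η`, (4.10). [GilbargTrudinger2001]
-/

noncomputable section

open MeasureTheory Set Function Filter Metric Real
open _root_.Topology
open scoped RealInnerProductSpace

namespace Literature.Analysis.FluidPDE

open NewtonPotentialHolder

-- nested operator types `ℝ³ →L[ℝ] ℝ³ →L[ℝ] ℝ³ →L[ℝ] ℝ` (third derivatives)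
set_option maxSynthPendingDepth 3

/-- Local notation for physical space `ℝ³ = EuclideanSpace ℝ (Fin 3)`. -/
local notation "ℝ³" => EuclideanSpace ℝ (Fin 3)

/-! ### Homogeneous functions: the power bound -/

/-- **Power bound for homogeneous functions**: if `Φ` is continuous off the origin and
`Φ(c z) = cᵐ Φ(z)` for `c > 0`, then `‖Φ z‖ ≤ M |z|ᵐ` for all `z ≠ 0`, with `M ≥ 0` a bound of
`Φ` on the unit sphere (compact). [folklore] -/
theorem exists_norm_le_mul_rpow_of_homogeneous {F : Type*} [NormedAddCommGroup F]
    [NormedSpace ℝ F] (Φ : ℝ³ → F) (m : ℤ)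
    (hΦ : ∀ c : ℝ, 0 < c → ∀ z, Φ (c • z) = c ^ m • Φ z) (hc : ContinuousOn Φ {0}ᶜ) :
    ∃ M, 0 ≤ M ∧ ∀ z : ℝ³, z ≠ 0 → ‖Φ z‖ ≤ M * ‖z‖ ^ (m : ℝ) := by
  have hs : sphere (0 : ℝ³) 1 ⊆ {0}ᶜ := fun w hw h0 => by
    rw [mem_sphere_zero_iff_norm] at hw
    rw [mem_singleton_iff] at h0
    rw [h0, norm_zero] at hw
    exact zero_ne_one hw
  obtain ⟨M, hM⟩ := (isCompact_sphere (0 : ℝ³) 1).exists_bound_of_continuousOn (hc.mono hs)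
  refine ⟨max M 0, le_max_right _ _, fun z hz => ?_⟩
  have hz' : 0 < ‖z‖ := norm_pos_iff.2 hz
  set w : ℝ³ := ‖z‖⁻¹ • z with hw
  have hws : w ∈ sphere (0 : ℝ³) 1 := by
    rw [mem_sphere_zero_iff_norm, hw, norm_smul, norm_inv, norm_norm, inv_mul_cancel₀ hz'.ne']
  have hzw : z = ‖z‖ • w := by rw [hw, smul_smul, mul_inv_cancel₀ hz'.ne', one_smul]
  calc ‖Φ z‖ = ‖Φ (‖z‖ • w)‖ := by rw [← hzw]
    _ = ‖(‖z‖ ^ m) • Φ w‖ := by rw [hΦ _ hz' w]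
    _ = ‖z‖ ^ (m : ℝ) * ‖Φ w‖ := by
        rw [norm_smul, norm_zpow, norm_norm, Real.rpow_intCast]
    _ ≤ ‖z‖ ^ (m : ℝ) * max M 0 :=
        mul_le_mul_of_nonneg_left ((hM w hws).trans (le_max_left _ _))
          (Real.rpow_nonneg hz'.le _)
    _ = max M 0 * ‖z‖ ^ (m : ℝ) := mul_comm _ _

/-! ### Power bounds for the derivatives of `Γ` -/

/-- `‖DΓ(z)‖ ≤ (4π)⁻¹ |z|⁻²` in `rpow` form (equality for `z ≠ 0`). [folklore] -/
theorem norm_fderiv_newtonKernel_le_rpow {z : ℝ³} (hz : z ≠ 0) :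
    ‖fderiv ℝ newtonKernel z‖ ≤ (4 * π)⁻¹ * ‖z‖ ^ (-(2 : ℝ)) := by
  rw [norm_fderiv_newtonKernel hz, Real.rpow_neg (norm_nonneg _),
    show (2 : ℝ) = ((2 : ℕ) : ℝ) by norm_num, Real.rpow_natCast, mul_inv]

/-- **`‖D²Γ(z)‖ ≤ M₂ |z|⁻³`** for `z ≠ 0` (homogeneity of degree `−3` and continuity off the
origin). [folklore] -/
theorem exists_norm_fderiv2_newtonKernel_le_rpow :
    ∃ M, 0 ≤ M ∧ ∀ z : ℝ³, z ≠ 0 →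
      ‖fderiv ℝ (fderiv ℝ newtonKernel) z‖ ≤ M * ‖z‖ ^ (-(3 : ℝ)) := by
  obtain ⟨M, hM0, hM⟩ := exists_norm_le_mul_rpow_of_homogeneous _ (-3)
    fderiv2_newtonKernel_homogeneous (contDiffOn_fderiv2_newtonKernel (n := 0)).continuousOn
  exact ⟨M, hM0, fun z hz => by simpa using hM z hz⟩

/-- **`‖D³Γ(z)‖ ≤ M₃ |z|⁻⁴`** for `z ≠ 0`. [folklore] -/
theorem exists_norm_fderiv3_newtonKernel_le_rpow :
    ∃ M, 0 ≤ M ∧ ∀ z : ℝ³, z ≠ 0 →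
      ‖fderiv ℝ (fderiv ℝ (fderiv ℝ newtonKernel)) z‖ ≤ M * ‖z‖ ^ (-(4 : ℝ)) := by
  obtain ⟨M, hM0, hM⟩ := exists_norm_le_mul_rpow_of_homogeneous _ (-4)
    fderiv3_newtonKernel_homogeneous (contDiffOn_fderiv3_newtonKernel (n := 0)).continuousOn
  exact ⟨M, hM0, fun z hz => by simpa using hM z hz⟩

/-! ### The derivatives of `Γ₀` off the origin, near the origin, and far away -/

section Near

variable {r₀ r₁ : ℝ}

/-- `Γ₀` is smooth on the complement of the origin. [folklore] -/
theorem contDiffOn_newtonNear (r₀ r₁ : ℝ) {n : ℕ∞} :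
    ContDiffOn ℝ n (newtonNear r₀ r₁) ({0}ᶜ : Set ℝ³) :=
  fun _ hz => (contDiffAt_newtonNear r₀ r₁ hz).contDiffWithinAt

/-- `DΓ₀` is smooth off the origin. [folklore] -/
theorem contDiffOn_fderiv_newtonNear (r₀ r₁ : ℝ) {n : ℕ∞} :
    ContDiffOn ℝ n (fderiv ℝ (newtonNear r₀ r₁)) ({0}ᶜ : Set ℝ³) :=
  (contDiffOn_newtonNear r₀ r₁ (n := n + 1)).fderiv_of_isOpen isOpen_compl_singleton
    (by exact_mod_cast le_rfl)

/-- `D²Γ₀` is smooth off the origin. [folklore] -/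
theorem contDiffOn_fderiv2_newtonNear (r₀ r₁ : ℝ) {n : ℕ∞} :
    ContDiffOn ℝ n (fderiv ℝ (fderiv ℝ (newtonNear r₀ r₁))) ({0}ᶜ : Set ℝ³) :=
  (contDiffOn_fderiv_newtonNear r₀ r₁ (n := n + 1)).fderiv_of_isOpen isOpen_compl_singleton
    (by exact_mod_cast le_rfl)

/-- `DΓ₀` is `C^n` at every `z ≠ 0`. [folklore] -/
theorem contDiffAt_fderiv_newtonNear (r₀ r₁ : ℝ) {z : ℝ³} (hz : z ≠ 0) {n : ℕ∞} :
    ContDiffAt ℝ n (fderiv ℝ (newtonNear r₀ r₁)) z :=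
  (contDiffOn_fderiv_newtonNear r₀ r₁).contDiffAt (isOpen_compl_singleton.mem_nhds hz)

/-- `D²Γ₀` is `C^n` at every `z ≠ 0`. [folklore] -/
theorem contDiffAt_fderiv2_newtonNear (r₀ r₁ : ℝ) {z : ℝ³} (hz : z ≠ 0) {n : ℕ∞} :
    ContDiffAt ℝ n (fderiv ℝ (fderiv ℝ (newtonNear r₀ r₁))) z :=
  (contDiffOn_fderiv2_newtonNear r₀ r₁).contDiffAt (isOpen_compl_singleton.mem_nhds hz)

/-- **`DΓ₀ = DΓ − DΓ∞` off the origin** (`Γ₀ = Γ − Γ∞` everywhere, both differentiable at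
`z ≠ 0`). [folklore] -/
theorem fderiv_newtonNear_eq_sub (h₀ : 0 < r₀) (h₁ : r₀ < r₁) {z : ℝ³} (hz : z ≠ 0) :
    fderiv ℝ (newtonNear r₀ r₁) z = fderiv ℝ newtonKernel z - fderiv ℝ (newtonFar r₀ r₁) z := by
  rw [newtonNear_eq_sub]
  exact fderiv_fun_sub (contDiffAt_newtonKernel hz (n := 1)).differentiableAt_one
    ((contDiff_newtonFar h₀ h₁ (n := 1)).differentiable one_ne_zero z)

/-- `DΓ₀ = DΓ − DΓ∞` near every `z ≠ 0`. [folklore] -/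
theorem fderiv_newtonNear_eventuallyEq_sub (h₀ : 0 < r₀) (h₁ : r₀ < r₁) {z : ℝ³} (hz : z ≠ 0) :
    fderiv ℝ (newtonNear r₀ r₁) =ᶠ[𝓝 z]
      fun w => fderiv ℝ newtonKernel w - fderiv ℝ (newtonFar r₀ r₁) w := by
  filter_upwards [isOpen_compl_singleton.mem_nhds hz] with w hw
  exact fderiv_newtonNear_eq_sub h₀ h₁ hw

/-- **`D²Γ₀ = D²Γ − D²Γ∞` off the origin.** [folklore] -/
theorem fderiv2_newtonNear_eq_sub (h₀ : 0 < r₀) (h₁ : r₀ < r₁) {z : ℝ³} (hz : z ≠ 0) :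
    fderiv ℝ (fderiv ℝ (newtonNear r₀ r₁)) z =
      fderiv ℝ (fderiv ℝ newtonKernel) z - fderiv ℝ (fderiv ℝ (newtonFar r₀ r₁)) z := by
  rw [(fderiv_newtonNear_eventuallyEq_sub h₀ h₁ hz).fderiv_eq]
  have h1 : DifferentiableAt ℝ (fderiv ℝ newtonKernel) z :=
    ((contDiffOn_fderiv_newtonKernel (n := 1)).contDiffAt
      (isOpen_compl_singleton.mem_nhds hz)).differentiableAt_one
  have h2 : DifferentiableAt ℝ (fderiv ℝ (newtonFar r₀ r₁)) z :=
    ((contDiff_newtonFar h₀ h₁ (n := 2)).fderiv_right (m := 1) le_rfl).differentiable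
      one_ne_zero z
  exact fderiv_fun_sub h1 h2

/-- `D²Γ₀ = D²Γ − D²Γ∞` near every `z ≠ 0`. [folklore] -/
theorem fderiv2_newtonNear_eventuallyEq_sub (h₀ : 0 < r₀) (h₁ : r₀ < r₁) {z : ℝ³} (hz : z ≠ 0) :
    fderiv ℝ (fderiv ℝ (newtonNear r₀ r₁)) =ᶠ[𝓝 z]
      fun w => fderiv ℝ (fderiv ℝ newtonKernel) w - fderiv ℝ (fderiv ℝ (newtonFar r₀ r₁)) w := by
  filter_upwards [isOpen_compl_singleton.mem_nhds hz] with w hw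
  exact fderiv2_newtonNear_eq_sub h₀ h₁ hw

/-- **`D³Γ₀ = D³Γ − D³Γ∞` off the origin.** [folklore] -/
theorem fderiv3_newtonNear_eq_sub (h₀ : 0 < r₀) (h₁ : r₀ < r₁) {z : ℝ³} (hz : z ≠ 0) :
    fderiv ℝ (fderiv ℝ (fderiv ℝ (newtonNear r₀ r₁))) z =
      fderiv ℝ (fderiv ℝ (fderiv ℝ newtonKernel)) z -
        fderiv ℝ (fderiv ℝ (fderiv ℝ (newtonFar r₀ r₁))) z := by
  rw [(fderiv2_newtonNear_eventuallyEq_sub h₀ h₁ hz).fderiv_eq]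
  have h1 : DifferentiableAt ℝ (fderiv ℝ (fderiv ℝ newtonKernel)) z :=
    ((contDiffOn_fderiv2_newtonKernel (n := 1)).contDiffAt
      (isOpen_compl_singleton.mem_nhds hz)).differentiableAt_one
  have h2 : DifferentiableAt ℝ (fderiv ℝ (fderiv ℝ (newtonFar r₀ r₁))) z :=
    (((contDiff_newtonFar h₀ h₁ (n := 3)).fderiv_right (m := 2) le_rfl).fderiv_right
      (m := 1) le_rfl).differentiable one_ne_zero z
  exact fderiv_fun_sub h1 h2

/-- `Γ₀ = 0` near every point off the closed ball of radius `r₁`. [folklore] -/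
theorem newtonNear_eventuallyEq_zero (h₀ : 0 ≤ r₀) (h₁ : r₀ < r₁) {z : ℝ³} (hz : r₁ < ‖z‖) :
    newtonNear r₀ r₁ =ᶠ[𝓝 z] fun _ => (0 : ℝ) := by
  filter_upwards [radialCutoff_eventuallyEq_zero (E := ℝ³) h₀ h₁ hz] with w hw
  rw [newtonNear, hw, zero_mul]

/-- **`DΓ₀ = 0` off the closed ball of radius `r₁`.** [folklore] -/
theorem fderiv_newtonNear_eq_zero_of_lt (h₀ : 0 ≤ r₀) (h₁ : r₀ < r₁) {z : ℝ³} (hz : r₁ < ‖z‖) :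
    fderiv ℝ (newtonNear r₀ r₁) z = 0 := by
  rw [(newtonNear_eventuallyEq_zero h₀ h₁ hz).fderiv_eq, fderiv_const_apply]

/-- `DΓ₀ = 0` near every point off the closed ball of radius `r₁`. [folklore] -/
theorem fderiv_newtonNear_eventuallyEq_zero (h₀ : 0 ≤ r₀) (h₁ : r₀ < r₁) {z : ℝ³}
    (hz : r₁ < ‖z‖) : fderiv ℝ (newtonNear r₀ r₁) =ᶠ[𝓝 z] fun _ => (0 : ℝ³ →L[ℝ] ℝ) := by
  have hopen : IsOpen {w : ℝ³ | r₁ < ‖w‖} := isOpen_lt continuous_const continuous_norm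
  filter_upwards [hopen.mem_nhds hz] with w hw
  exact fderiv_newtonNear_eq_zero_of_lt h₀ h₁ hw

/-- **`D²Γ₀ = 0` off the closed ball of radius `r₁`.** [folklore] -/
theorem fderiv2_newtonNear_eq_zero_of_lt (h₀ : 0 ≤ r₀) (h₁ : r₀ < r₁) {z : ℝ³} (hz : r₁ < ‖z‖) :
    fderiv ℝ (fderiv ℝ (newtonNear r₀ r₁)) z = 0 := by
  rw [(fderiv_newtonNear_eventuallyEq_zero h₀ h₁ hz).fderiv_eq, fderiv_const_apply]

/-- `D²Γ₀ = 0` near every point off the closed ball of radius `r₁`. [folklore] -/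
theorem fderiv2_newtonNear_eventuallyEq_zero (h₀ : 0 ≤ r₀) (h₁ : r₀ < r₁) {z : ℝ³}
    (hz : r₁ < ‖z‖) :
    fderiv ℝ (fderiv ℝ (newtonNear r₀ r₁)) =ᶠ[𝓝 z] fun _ => (0 : ℝ³ →L[ℝ] ℝ³ →L[ℝ] ℝ) := by
  have hopen : IsOpen {w : ℝ³ | r₁ < ‖w‖} := isOpen_lt continuous_const continuous_norm
  filter_upwards [hopen.mem_nhds hz] with w hw
  exact fderiv2_newtonNear_eq_zero_of_lt h₀ h₁ hw

/-- **`D³Γ₀ = 0` off the closed ball of radius `r₁`.** [folklore] -/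
theorem fderiv3_newtonNear_eq_zero_of_lt (h₀ : 0 ≤ r₀) (h₁ : r₀ < r₁) {z : ℝ³} (hz : r₁ < ‖z‖) :
    fderiv ℝ (fderiv ℝ (fderiv ℝ (newtonNear r₀ r₁))) z = 0 := by
  rw [(fderiv2_newtonNear_eventuallyEq_zero h₀ h₁ hz).fderiv_eq, fderiv_const_apply]

/-- **`DΓ₀ = DΓ` on the open ball of radius `r₀`** (where `Γ₀ = Γ`). [folklore] -/
theorem fderiv_newtonNear_eq_of_lt (h₀ : 0 ≤ r₀) (h₁ : r₀ < r₁) {z : ℝ³} (hz : ‖z‖ < r₀) :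
    fderiv ℝ (newtonNear r₀ r₁) z = fderiv ℝ newtonKernel z :=
  (newtonNear_eventuallyEq_newtonKernel h₀ h₁ hz).fderiv_eq

/-- **`D²Γ₀ = D²Γ` on the open ball of radius `r₀`.** [folklore] -/
theorem fderiv2_newtonNear_eq_of_lt (h₀ : 0 ≤ r₀) (h₁ : r₀ < r₁) {z : ℝ³} (hz : ‖z‖ < r₀) :
    fderiv ℝ (fderiv ℝ (newtonNear r₀ r₁)) z = fderiv ℝ (fderiv ℝ newtonKernel) z :=
  ((newtonNear_eventuallyEq_newtonKernel h₀ h₁ hz).fderiv (𝕜 := ℝ)).fderiv_eq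

/-! ### The junk values at the origin -/

/-- The unit vector `e₀`. [folklore] -/
theorem norm_single_zero_one : ‖(EuclideanSpace.single 0 1 : ℝ³)‖ = 1 := by simp

/-- **`Γ₀` is discontinuous at the origin** (`Γ₀(0) = 0` is a junk value while
`|Γ₀(t e)| = (4πt)⁻¹ → ∞`). [folklore] -/
theorem not_continuousAt_newtonNear_zero (h₀ : 0 < r₀) (h₁ : r₀ < r₁) :
    ¬ContinuousAt (newtonNear r₀ r₁) (0 : ℝ³) := by
  intro hc
  set e : ℝ³ := EuclideanSpace.single 0 1 with he
  have hen : ‖e‖ = 1 := norm_single_zero_one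
  have h00 : newtonNear r₀ r₁ 0 = 0 := by
    rw [newtonNear, newtonKernel_eq, norm_zero, mul_zero, inv_zero, neg_zero, mul_zero]
  have hev : ∀ᶠ w in 𝓝 (0 : ℝ³), ‖newtonNear r₀ r₁ w‖ < 1 := by
    have ht : Tendsto (fun w => ‖newtonNear r₀ r₁ w‖) (𝓝 0) (𝓝 0) := by
      have := hc.tendsto.norm
      rwa [h00, norm_zero] at this
    exact ht.eventually_lt_const zero_lt_one
  rw [Metric.eventually_nhds_iff] at hev
  obtain ⟨δ, hδ, hball⟩ := hev
  set t : ℝ := min (δ / 2) (min r₀ (4 * π)⁻¹) with ht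
  have htpos : 0 < t := lt_min (by linarith) (lt_min h₀ (by positivity))
  have htδ : t < δ := (min_le_left _ _).trans_lt (by linarith)
  have htr : t ≤ r₀ := (min_le_right _ _).trans (min_le_left _ _)
  have htπ : t ≤ (4 * π)⁻¹ := (min_le_right _ _).trans (min_le_right _ _)
  have hw : ‖t • e‖ = t := by rw [norm_smul, hen, mul_one, Real.norm_eq_abs, abs_of_pos htpos]
  have h1 := hball (y := t • e) (by rwa [dist_zero_right, hw])
  rw [newtonNear_eq_newtonKernel h₀.le h₁ (by rw [hw]; exact htr), Real.norm_eq_abs,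
    abs_newtonKernel, hw] at h1
  have h2 : 1 ≤ (4 * π * t)⁻¹ := by
    rw [one_le_inv₀ (by positivity)]
    calc 4 * π * t ≤ 4 * π * (4 * π)⁻¹ := by gcongr
      _ = 1 := mul_inv_cancel₀ (by positivity)
  linarith

/-- **The junk value `DΓ₀(0) = 0`** (`Γ₀` is not differentiable at the origin). [folklore] -/
theorem fderiv_newtonNear_zero (h₀ : 0 < r₀) (h₁ : r₀ < r₁) :
    fderiv ℝ (newtonNear r₀ r₁) (0 : ℝ³) = 0 :=
  fderiv_zero_of_not_differentiableAt fun h =>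
    not_continuousAt_newtonNear_zero h₀ h₁ h.continuousAt

/-- **`DΓ₀` is discontinuous at the origin** (`‖DΓ₀(t e)‖ = (4πt²)⁻¹ → ∞`). [folklore] -/
theorem not_continuousAt_fderiv_newtonNear_zero (h₀ : 0 < r₀) (h₁ : r₀ < r₁) :
    ¬ContinuousAt (fderiv ℝ (newtonNear r₀ r₁)) (0 : ℝ³) := by
  intro hc
  set e : ℝ³ := EuclideanSpace.single 0 1 with he
  have hen : ‖e‖ = 1 := norm_single_zero_one
  set L : ℝ := ‖fderiv ℝ (newtonNear r₀ r₁) (0 : ℝ³)‖ + 1 with hL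
  have hL1 : 1 ≤ L := by rw [hL]; linarith [norm_nonneg (fderiv ℝ (newtonNear r₀ r₁) (0 : ℝ³))]
  have hL0 : 0 < L := by linarith
  have hev : ∀ᶠ w in 𝓝 (0 : ℝ³), ‖fderiv ℝ (newtonNear r₀ r₁) w‖ < L := by
    have ht := hc.tendsto.norm
    exact ht.eventually_lt_const (by rw [hL]; linarith)
  rw [Metric.eventually_nhds_iff] at hev
  obtain ⟨δ, hδ, hball⟩ := hev
  set t : ℝ := min (δ / 2) (min (r₀ / 2) (4 * π * L)⁻¹) with ht
  have htpos : 0 < t := lt_min (by linarith) (lt_min (by linarith) (by positivity))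
  have htδ : t < δ := (min_le_left _ _).trans_lt (by linarith)
  have htr : t < r₀ := ((min_le_right _ _).trans (min_le_left _ _)).trans_lt (by linarith)
  have htL : t ≤ (4 * π * L)⁻¹ := (min_le_right _ _).trans (min_le_right _ _)
  have ht1 : t ≤ 1 := by
    refine htL.trans ?_
    rw [inv_le_one₀ (by positivity)]
    nlinarith [Real.pi_gt_three]
  have hw : ‖t • e‖ = t := by rw [norm_smul, hen, mul_one, Real.norm_eq_abs, abs_of_pos htpos]
  have hne : t • e ≠ 0 := by rw [← norm_pos_iff, hw]; exact htpos
  have h1 := hball (y := t • e) (by rwa [dist_zero_right, hw])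
  rw [fderiv_newtonNear_eq_of_lt h₀.le h₁ (by rw [hw]; exact htr), norm_fderiv_newtonKernel hne,
    hw] at h1
  -- `(4π t²)⁻¹ ≥ L` since `t² ≤ t ≤ (4πL)⁻¹`
  have h2 : L ≤ (4 * π * t ^ 2)⁻¹ := by
    rw [le_inv_comm₀ hL0 (by positivity)]
    calc 4 * π * t ^ 2 ≤ 4 * π * t := by
          have : t ^ 2 ≤ t := by nlinarith
          gcongr
      _ ≤ 4 * π * (4 * π * L)⁻¹ := by gcongr
      _ = L⁻¹ := by field_simp
  linarith

/-- **The junk value `D²Γ₀(0) = 0`** (`DΓ₀` is not differentiable at the origin). [folklore] -/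
theorem fderiv2_newtonNear_zero (h₀ : 0 < r₀) (h₁ : r₀ < r₁) :
    fderiv ℝ (fderiv ℝ (newtonNear r₀ r₁)) (0 : ℝ³) = 0 :=
  fderiv_zero_of_not_differentiableAt fun h =>
    not_continuousAt_fderiv_newtonNear_zero h₀ h₁ h.continuousAt

/-! ### Power bounds for the derivatives of `Γ₀` -/

/-- A constant is bounded by a negative power on a ball: for `0 < |z| ≤ r₁` and `N ≥ 0`,
`N ≤ N r₁ᵏ |z|⁻ᵏ`. [folklore] -/
theorem const_le_mul_rpow_neg {N r k : ℝ} (hN : 0 ≤ N) {z : ℝ³} (hz : z ≠ 0) (hzr : ‖z‖ ≤ r)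
    (hk : 0 ≤ k) : N ≤ N * r ^ k * ‖z‖ ^ (-k) := by
  have hz' : 0 < ‖z‖ := norm_pos_iff.2 hz
  have h1 : 1 ≤ r ^ k * ‖z‖ ^ (-k) := by
    rw [Real.rpow_neg hz'.le, ← div_eq_mul_inv, one_le_div (Real.rpow_pos_of_pos hz' _)]
    exact Real.rpow_le_rpow hz'.le hzr hk
  calc N = N * 1 := (mul_one N).symm
    _ ≤ N * (r ^ k * ‖z‖ ^ (-k)) := mul_le_mul_of_nonneg_left h1 hN
    _ = N * r ^ k * ‖z‖ ^ (-k) := by ring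

/-- **`‖DΓ₀(z)‖ ≤ C₁ |z|⁻²`** for `z ≠ 0`, with `C₁ = (4π)⁻¹ + N₁r₁²` (`N₁` a bound for `DΓ∞`).
[folklore] -/
theorem exists_norm_fderiv_newtonNear_le (h₀ : 0 < r₀) (h₁ : r₀ < r₁) :
    ∃ C, 0 ≤ C ∧ ∀ z : ℝ³, z ≠ 0 →
      ‖fderiv ℝ (newtonNear r₀ r₁) z‖ ≤ C * ‖z‖ ^ (-(2 : ℝ)) := by
  obtain ⟨N, hN⟩ := (exists_bound_newtonFar_derivs h₀ h₁).2.1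
  have hN0 : 0 ≤ N := (norm_nonneg _).trans (hN 0)
  have hr₁ : 0 < r₁ := h₀.trans h₁
  refine ⟨(4 * π)⁻¹ + N * r₁ ^ (2 : ℝ), by positivity, fun z hz => ?_⟩
  by_cases hfar : r₁ < ‖z‖
  · rw [fderiv_newtonNear_eq_zero_of_lt h₀.le h₁ hfar, norm_zero]
    positivity
  rw [not_lt] at hfar
  rw [fderiv_newtonNear_eq_sub h₀ h₁ hz]
  calc ‖fderiv ℝ newtonKernel z - fderiv ℝ (newtonFar r₀ r₁) z‖
      ≤ ‖fderiv ℝ newtonKernel z‖ + ‖fderiv ℝ (newtonFar r₀ r₁) z‖ := norm_sub_le _ _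
    _ ≤ (4 * π)⁻¹ * ‖z‖ ^ (-(2 : ℝ)) + N * r₁ ^ (2 : ℝ) * ‖z‖ ^ (-(2 : ℝ)) :=
        add_le_add (norm_fderiv_newtonKernel_le_rpow hz)
          ((hN z).trans (const_le_mul_rpow_neg hN0 hz hfar (by norm_num)))
    _ = ((4 * π)⁻¹ + N * r₁ ^ (2 : ℝ)) * ‖z‖ ^ (-(2 : ℝ)) := by ring

/-- **`‖D²Γ₀(z)‖ ≤ C₂ |z|⁻³`** for `z ≠ 0`, with `C₂ = M₂ + N₂r₁³`. [folklore] -/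
theorem exists_norm_fderiv2_newtonNear_le (h₀ : 0 < r₀) (h₁ : r₀ < r₁) :
    ∃ C, 0 ≤ C ∧ ∀ z : ℝ³, z ≠ 0 →
      ‖fderiv ℝ (fderiv ℝ (newtonNear r₀ r₁)) z‖ ≤ C * ‖z‖ ^ (-(3 : ℝ)) := by
  obtain ⟨N, hN⟩ := (exists_bound_newtonFar_derivs h₀ h₁).2.2.1
  obtain ⟨M, hM0, hM⟩ := exists_norm_fderiv2_newtonKernel_le_rpow
  have hN0 : 0 ≤ N := (norm_nonneg _).trans (hN 0)
  have hr₁ : 0 < r₁ := h₀.trans h₁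
  refine ⟨M + N * r₁ ^ (3 : ℝ), by positivity, fun z hz => ?_⟩
  by_cases hfar : r₁ < ‖z‖
  · rw [fderiv2_newtonNear_eq_zero_of_lt h₀.le h₁ hfar, norm_zero]
    positivity
  rw [not_lt] at hfar
  rw [fderiv2_newtonNear_eq_sub h₀ h₁ hz]
  calc ‖fderiv ℝ (fderiv ℝ newtonKernel) z - fderiv ℝ (fderiv ℝ (newtonFar r₀ r₁)) z‖
      ≤ ‖fderiv ℝ (fderiv ℝ newtonKernel) z‖ + ‖fderiv ℝ (fderiv ℝ (newtonFar r₀ r₁)) z‖ :=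
        norm_sub_le _ _
    _ ≤ M * ‖z‖ ^ (-(3 : ℝ)) + N * r₁ ^ (3 : ℝ) * ‖z‖ ^ (-(3 : ℝ)) :=
        add_le_add (hM z hz) ((hN z).trans (const_le_mul_rpow_neg hN0 hz hfar (by norm_num)))
    _ = (M + N * r₁ ^ (3 : ℝ)) * ‖z‖ ^ (-(3 : ℝ)) := by ring

/-- **`‖D³Γ₀(z)‖ ≤ C₃ |z|⁻⁴`** for `z ≠ 0`, with `C₃ = M₃ + N₃r₁⁴`. [folklore] -/
theorem exists_norm_fderiv3_newtonNear_le (h₀ : 0 < r₀) (h₁ : r₀ < r₁) :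
    ∃ C, 0 ≤ C ∧ ∀ z : ℝ³, z ≠ 0 →
      ‖fderiv ℝ (fderiv ℝ (fderiv ℝ (newtonNear r₀ r₁))) z‖ ≤ C * ‖z‖ ^ (-(4 : ℝ)) := by
  obtain ⟨N, hN⟩ := (exists_bound_newtonFar_derivs h₀ h₁).2.2.2.1
  obtain ⟨M, hM0, hM⟩ := exists_norm_fderiv3_newtonKernel_le_rpow
  have hN0 : 0 ≤ N := (norm_nonneg _).trans (hN 0)
  have hr₁ : 0 < r₁ := h₀.trans h₁
  refine ⟨M + N * r₁ ^ (4 : ℝ), by positivity, fun z hz => ?_⟩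
  by_cases hfar : r₁ < ‖z‖
  · rw [fderiv3_newtonNear_eq_zero_of_lt h₀.le h₁ hfar, norm_zero]
    positivity
  rw [not_lt] at hfar
  rw [fderiv3_newtonNear_eq_sub h₀ h₁ hz]
  calc ‖fderiv ℝ (fderiv ℝ (fderiv ℝ newtonKernel)) z -
        fderiv ℝ (fderiv ℝ (fderiv ℝ (newtonFar r₀ r₁))) z‖
      ≤ ‖fderiv ℝ (fderiv ℝ (fderiv ℝ newtonKernel)) z‖ +
          ‖fderiv ℝ (fderiv ℝ (fderiv ℝ (newtonFar r₀ r₁))) z‖ := norm_sub_le _ _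
    _ ≤ M * ‖z‖ ^ (-(4 : ℝ)) + N * r₁ ^ (4 : ℝ) * ‖z‖ ^ (-(4 : ℝ)) :=
        add_le_add (hM z hz) ((hN z).trans (const_le_mul_rpow_neg hN0 hz hfar (by norm_num)))
    _ = (M + N * r₁ ^ (4 : ℝ)) * ‖z‖ ^ (-(4 : ℝ)) := by ring

/-! ### The kernels `∂_aΓ₀` and `∂_b∂_aΓ₀` as functions -/

/-- **The gradient kernel `∂_aΓ₀(z) = DΓ₀(z) a`** of the near-field Newtonian kernel, the kernel
of the first-derivative potential `∫ ∂_aΓ₀(x − y) f(y) dy` (Gilbarg–Trudinger (4.10)/Lemma 4.2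
with a smooth cutoff). Everywhere defined; `= ⟨z, a⟩/(4π|z|³)` for `0 < |z| < r₀`, `= 0` at the
origin (junk) and for `|z| ≥ r₁`. [cite: GilbargTrudinger2001, Lemma 4.2 with (4.10)] -/
def newtonNearGrad (r₀ r₁ : ℝ) (a z : ℝ³) : ℝ :=
  fderiv ℝ (newtonNear r₀ r₁) z a

/-- **The Hessian kernel `∂_b∂_aΓ₀(z) = D²Γ₀(z)(b)(a)`** of the near-field Newtonian kernel —
the compactly supported Calderón–Zygmund kernel of Hölder theory (`IsHolderCZKernel`,
`NewtonNearCZ.lean`; Majda–Bertozzi's `P_N = ∇K_N` (4.31)–(4.33) localised by the cutoff).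
Everywhere defined; `= (⟨a,b⟩|z|² − 3⟨z,a⟩⟨z,b⟩)/(4π|z|⁵)` for `0 < |z| < r₀`, `= 0` at the
origin (junk) and for `|z| ≥ r₁`. [cite: MajdaBertozziCUP2002, §4.1.3 (4.31)–(4.33) (p. 129)] -/
def newtonNearHess (r₀ r₁ : ℝ) (a b z : ℝ³) : ℝ :=
  fderiv ℝ (fderiv ℝ (newtonNear r₀ r₁)) z b a

/-- Unfolding `newtonNearGrad`. [folklore] -/
theorem newtonNearGrad_apply (r₀ r₁ : ℝ) (a z : ℝ³) :
    newtonNearGrad r₀ r₁ a z = fderiv ℝ (newtonNear r₀ r₁) z a := rfl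

/-- Unfolding `newtonNearHess`. [folklore] -/
theorem newtonNearHess_apply (r₀ r₁ : ℝ) (a b z : ℝ³) :
    newtonNearHess r₀ r₁ a b z = fderiv ℝ (fderiv ℝ (newtonNear r₀ r₁)) z b a := rfl

/-- `∂_aΓ₀(z) = ⟨z, a⟩/(4π|z|³)` for `0 < |z| < r₀`. [folklore] -/
theorem newtonNearGrad_eq_of_lt (h₀ : 0 ≤ r₀) (h₁ : r₀ < r₁) (a : ℝ³) {z : ℝ³} (hz : z ≠ 0)
    (hzr : ‖z‖ < r₀) : newtonNearGrad r₀ r₁ a z = ⟪z, a⟫ / (4 * π * ‖z‖ ^ 3) := by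
  rw [newtonNearGrad, fderiv_newtonNear_eq_of_lt h₀ h₁ hzr, fderiv_newtonKernel_apply hz]

/-- `∂_aΓ₀(0) = 0` (junk value). [folklore] -/
theorem newtonNearGrad_zero (h₀ : 0 < r₀) (h₁ : r₀ < r₁) (a : ℝ³) :
    newtonNearGrad r₀ r₁ a 0 = 0 := by
  rw [newtonNearGrad, fderiv_newtonNear_zero h₀ h₁, zero_apply]

/-- `∂_b∂_aΓ₀(0) = 0` (junk value). [folklore] -/
theorem newtonNearHess_zero (h₀ : 0 < r₀) (h₁ : r₀ < r₁) (a b : ℝ³) :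
    newtonNearHess r₀ r₁ a b 0 = 0 := by
  rw [newtonNearHess, fderiv2_newtonNear_zero h₀ h₁]
  rfl

/-- `∂_aΓ₀(z) = 0` for `|z| > r₁`. [folklore] -/
theorem newtonNearGrad_eq_zero_of_lt (h₀ : 0 ≤ r₀) (h₁ : r₀ < r₁) (a : ℝ³) {z : ℝ³}
    (hz : r₁ < ‖z‖) : newtonNearGrad r₀ r₁ a z = 0 := by
  rw [newtonNearGrad, fderiv_newtonNear_eq_zero_of_lt h₀ h₁ hz, zero_apply]

/-- `∂_b∂_aΓ₀(z) = 0` for `|z| > r₁`. [folklore] -/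
theorem newtonNearHess_eq_zero_of_lt (h₀ : 0 ≤ r₀) (h₁ : r₀ < r₁) (a b : ℝ³) {z : ℝ³}
    (hz : r₁ < ‖z‖) : newtonNearHess r₀ r₁ a b z = 0 := by
  rw [newtonNearHess, fderiv2_newtonNear_eq_zero_of_lt h₀ h₁ hz]
  rfl

/-- `∂_aΓ₀` is smooth at every `z ≠ 0`. [folklore] -/
theorem contDiffAt_newtonNearGrad (r₀ r₁ : ℝ) (a : ℝ³) {z : ℝ³} (hz : z ≠ 0) {n : ℕ∞} :
    ContDiffAt ℝ n (newtonNearGrad r₀ r₁ a) z :=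
  (contDiffAt_fderiv_newtonNear r₀ r₁ hz).clm_apply contDiffAt_const

/-- `∂_b∂_aΓ₀` is smooth at every `z ≠ 0`. [folklore] -/
theorem contDiffAt_newtonNearHess (r₀ r₁ : ℝ) (a b : ℝ³) {z : ℝ³} (hz : z ≠ 0) {n : ℕ∞} :
    ContDiffAt ℝ n (newtonNearHess r₀ r₁ a b) z :=
  ((contDiffAt_fderiv2_newtonNear r₀ r₁ hz).clm_apply contDiffAt_const).clm_apply
    contDiffAt_const

/-- `∂_aΓ₀` is continuous off the origin. [folklore] -/
theorem continuousOn_newtonNearGrad (r₀ r₁ : ℝ) (a : ℝ³) :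
    ContinuousOn (newtonNearGrad r₀ r₁ a) ({0}ᶜ : Set ℝ³) := fun _ hz =>
  (contDiffAt_newtonNearGrad r₀ r₁ a hz (n := 0)).continuousAt.continuousWithinAt

/-- `∂_b∂_aΓ₀` is continuous off the origin. [folklore] -/
theorem continuousOn_newtonNearHess (r₀ r₁ : ℝ) (a b : ℝ³) :
    ContinuousOn (newtonNearHess r₀ r₁ a b) ({0}ᶜ : Set ℝ³) := fun _ hz =>
  (contDiffAt_newtonNearHess r₀ r₁ a b hz (n := 0)).continuousAt.continuousWithinAt

/-- **`∂_b(∂_aΓ₀) = ∂_b∂_aΓ₀` off the origin**: the gradient kernel is differentiable at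
`z ≠ 0` with derivative `b ↦ D²Γ₀(z)(b)(a)` (`HasFDerivAt` form). [folklore] -/
theorem hasFDerivAt_newtonNearGrad (r₀ r₁ : ℝ) (a : ℝ³) {z : ℝ³} (hz : z ≠ 0) :
    HasFDerivAt (newtonNearGrad r₀ r₁ a)
      ((fderiv ℝ (fderiv ℝ (newtonNear r₀ r₁)) z).flip a) z := by
  have hd : HasFDerivAt (fderiv ℝ (newtonNear r₀ r₁))
      (fderiv ℝ (fderiv ℝ (newtonNear r₀ r₁)) z) z :=
    (contDiffAt_fderiv_newtonNear r₀ r₁ hz (n := 1)).differentiableAt_one.hasFDerivAt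
  have h := hd.clm_apply (hasFDerivAt_const a z)
  rw [ContinuousLinearMap.comp_zero, zero_add] at h
  exact h

/-- `fderiv (∂_aΓ₀) z b = ∂_b∂_aΓ₀(z)` for `z ≠ 0`. [folklore] -/
theorem fderiv_newtonNearGrad_apply (r₀ r₁ : ℝ) (a b : ℝ³) {z : ℝ³} (hz : z ≠ 0) :
    fderiv ℝ (newtonNearGrad r₀ r₁ a) z b = newtonNearHess r₀ r₁ a b z := by
  rw [(hasFDerivAt_newtonNearGrad r₀ r₁ a hz).fderiv, ContinuousLinearMap.flip_apply,
    newtonNearHess]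

/-- `∂_aΓ₀` is differentiable at every `z ≠ 0`. [folklore] -/
theorem differentiableAt_newtonNearGrad (r₀ r₁ : ℝ) (a : ℝ³) {z : ℝ³} (hz : z ≠ 0) :
    DifferentiableAt ℝ (newtonNearGrad r₀ r₁ a) z :=
  (hasFDerivAt_newtonNearGrad r₀ r₁ a hz).differentiableAt

/-- **`∂_b∂_aΓ₀ = ∂_a∂_bΓ₀`** (symmetry of second derivatives off the origin; both vanish at the
origin). [folklore] -/
theorem newtonNearHess_comm (h₀ : 0 < r₀) (h₁ : r₀ < r₁) (a b z : ℝ³) :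
    newtonNearHess r₀ r₁ a b z = newtonNearHess r₀ r₁ b a z := by
  by_cases hz : z = 0
  · rw [hz, newtonNearHess_zero h₀ h₁, newtonNearHess_zero h₀ h₁]
  · have hs := (contDiffAt_newtonNear r₀ r₁ hz (n := 2)).isSymmSndFDerivAt (by simp)
    rw [newtonNearHess, newtonNearHess]
    exact hs b a

/-- **The derivative of the Hessian kernel** at `z ≠ 0`, in the direction `c`, is
`D³Γ₀(z)(c)(b)(a)`. [folklore] -/
theorem hasFDerivAt_newtonNearHess (r₀ r₁ : ℝ) (a b : ℝ³) {z : ℝ³} (hz : z ≠ 0) :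
    HasFDerivAt (newtonNearHess r₀ r₁ a b)
      (((fderiv ℝ (fderiv ℝ (fderiv ℝ (newtonNear r₀ r₁))) z).flip b).flip a) z := by
  have hd : HasFDerivAt (fderiv ℝ (fderiv ℝ (newtonNear r₀ r₁)))
      (fderiv ℝ (fderiv ℝ (fderiv ℝ (newtonNear r₀ r₁))) z) z :=
    (contDiffAt_fderiv2_newtonNear r₀ r₁ hz (n := 1)).differentiableAt_one.hasFDerivAt
  have h1 := hd.clm_apply (hasFDerivAt_const b z)
  rw [ContinuousLinearMap.comp_zero, zero_add] at h1
  have h2 := h1.clm_apply (hasFDerivAt_const a z)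
  rw [ContinuousLinearMap.comp_zero, zero_add] at h2
  exact h2

/-! ### Bounds for the kernels, valid at every point -/

/-- **`|∂_aΓ₀(z)| ≤ C₁ ‖a‖ |z|⁻²` for all `z`** (at the origin both sides vanish). [folklore] -/
theorem exists_abs_newtonNearGrad_le (h₀ : 0 < r₀) (h₁ : r₀ < r₁) :
    ∃ C, 0 ≤ C ∧ ∀ a z : ℝ³, |newtonNearGrad r₀ r₁ a z| ≤ C * ‖a‖ * ‖z‖ ^ (-(2 : ℝ)) := by
  obtain ⟨C, hC0, hC⟩ := exists_norm_fderiv_newtonNear_le h₀ h₁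
  refine ⟨C, hC0, fun a z => ?_⟩
  by_cases hz : z = 0
  · rw [hz, newtonNearGrad_zero h₀ h₁, abs_zero, norm_zero,
      Real.zero_rpow (by norm_num), mul_zero]
  rw [newtonNearGrad, ← Real.norm_eq_abs]
  calc ‖fderiv ℝ (newtonNear r₀ r₁) z a‖ ≤ ‖fderiv ℝ (newtonNear r₀ r₁) z‖ * ‖a‖ :=
        ContinuousLinearMap.le_opNorm _ _
    _ ≤ C * ‖z‖ ^ (-(2 : ℝ)) * ‖a‖ := mul_le_mul_of_nonneg_right (hC z hz) (norm_nonneg _)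
    _ = C * ‖a‖ * ‖z‖ ^ (-(2 : ℝ)) := by ring

/-- **`|∂_b∂_aΓ₀(z)| ≤ C₂ ‖a‖ ‖b‖ |z|⁻³` for all `z`.** [folklore] -/
theorem exists_abs_newtonNearHess_le (h₀ : 0 < r₀) (h₁ : r₀ < r₁) :
    ∃ C, 0 ≤ C ∧ ∀ a b z : ℝ³,
      |newtonNearHess r₀ r₁ a b z| ≤ C * ‖a‖ * ‖b‖ * ‖z‖ ^ (-(3 : ℝ)) := by
  obtain ⟨C, hC0, hC⟩ := exists_norm_fderiv2_newtonNear_le h₀ h₁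
  refine ⟨C, hC0, fun a b z => ?_⟩
  by_cases hz : z = 0
  · rw [hz, newtonNearHess_zero h₀ h₁, abs_zero, norm_zero,
      Real.zero_rpow (by norm_num), mul_zero]
  rw [newtonNearHess, ← Real.norm_eq_abs]
  set L := fderiv ℝ (fderiv ℝ (newtonNear r₀ r₁)) z with hL
  calc ‖L b a‖ ≤ ‖L b‖ * ‖a‖ := ContinuousLinearMap.le_opNorm _ _
    _ ≤ ‖L‖ * ‖b‖ * ‖a‖ := mul_le_mul_of_nonneg_right (L.le_opNorm b) (norm_nonneg _)
    _ ≤ C * ‖z‖ ^ (-(3 : ℝ)) * ‖b‖ * ‖a‖ := by gcongr; exact hC z hz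
    _ = C * ‖a‖ * ‖b‖ * ‖z‖ ^ (-(3 : ℝ)) := by ring

/-- **`‖D(∂_b∂_aΓ₀)(z)‖ ≤ C₃ ‖a‖ ‖b‖ |z|⁻⁴` for `z ≠ 0`.** [folklore] -/
theorem exists_norm_fderiv_newtonNearHess_le (h₀ : 0 < r₀) (h₁ : r₀ < r₁) :
    ∃ C, 0 ≤ C ∧ ∀ a b z : ℝ³, z ≠ 0 →
      ‖fderiv ℝ (newtonNearHess r₀ r₁ a b) z‖ ≤ C * ‖a‖ * ‖b‖ * ‖z‖ ^ (-(4 : ℝ)) := by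
  obtain ⟨C, hC0, hC⟩ := exists_norm_fderiv3_newtonNear_le h₀ h₁
  refine ⟨C, hC0, fun a b z hz => ?_⟩
  rw [(hasFDerivAt_newtonNearHess r₀ r₁ a b hz).fderiv]
  set L := fderiv ℝ (fderiv ℝ (fderiv ℝ (newtonNear r₀ r₁))) z with hL
  calc ‖(L.flip b).flip a‖ ≤ ‖(L.flip b).flip‖ * ‖a‖ := ContinuousLinearMap.le_opNorm _ _
    _ = ‖L.flip b‖ * ‖a‖ := by rw [ContinuousLinearMap.opNorm_flip]
    _ ≤ ‖L.flip‖ * ‖b‖ * ‖a‖ :=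
        mul_le_mul_of_nonneg_right (L.flip.le_opNorm b) (norm_nonneg _)
    _ = ‖L‖ * ‖b‖ * ‖a‖ := by rw [ContinuousLinearMap.opNorm_flip]
    _ ≤ C * ‖z‖ ^ (-(4 : ℝ)) * ‖b‖ * ‖a‖ := by gcongr; exact hC z hz
    _ = C * ‖a‖ * ‖b‖ * ‖z‖ ^ (-(4 : ℝ)) := by ring

/-! ### Vanishing for `|z| ≥ r₁`, supports, measurability, integrability -/

/-- A function continuous at a point `z` of the sphere `|z| = r`, `r > 0`, and vanishing off the
closed ball of radius `r`, vanishes at `z` (approach `z` by `c z`, `c ↓ 1`). [folklore] -/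
theorem eq_zero_of_continuousAt_of_forall_lt {g : ℝ³ → ℝ} {z : ℝ³} {r : ℝ} (hr : 0 < r)
    (hzr : ‖z‖ = r) (hg : ContinuousAt g z) (h : ∀ w : ℝ³, r < ‖w‖ → g w = 0) : g z = 0 := by
  have hlim : Tendsto (fun c : ℝ => g (c • z)) (𝓝[>] 1) (𝓝 (g z)) := by
    have hc : Tendsto (fun c : ℝ => c • z) (𝓝[>] (1 : ℝ)) (𝓝 z) := by
      have : Tendsto (fun c : ℝ => c • z) (𝓝 (1 : ℝ)) (𝓝 ((1 : ℝ) • z)) :=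
        tendsto_id.smul tendsto_const_nhds
      rw [one_smul] at this
      exact this.mono_left nhdsWithin_le_nhds
    exact hg.tendsto.comp hc
  have hzero : ∀ᶠ c in 𝓝[>] (1 : ℝ), g (c • z) = 0 := by
    filter_upwards [self_mem_nhdsWithin] with c hc
    refine h _ ?_
    rw [norm_smul, Real.norm_eq_abs, abs_of_pos (zero_lt_one.trans hc), hzr]
    exact lt_mul_left hr hc
  have hlim0 : Tendsto (fun c : ℝ => g (c • z)) (𝓝[>] 1) (𝓝 0) :=
    tendsto_const_nhds.congr' (hzero.mono fun c hc => hc.symm)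
  exact tendsto_nhds_unique hlim hlim0

/-- **`∂_aΓ₀(z) = 0` for `|z| ≥ r₁`.** [folklore] -/
theorem newtonNearGrad_eq_zero_of_le (h₀ : 0 < r₀) (h₁ : r₀ < r₁) (a : ℝ³) {z : ℝ³}
    (hz : r₁ ≤ ‖z‖) : newtonNearGrad r₀ r₁ a z = 0 := by
  rcases hz.lt_or_eq with hlt | heq
  · exact newtonNearGrad_eq_zero_of_lt h₀.le h₁ a hlt
  · have hr₁ : 0 < r₁ := h₀.trans h₁
    have hz0 : z ≠ 0 := by
      rw [← norm_pos_iff, ← heq]; exact hr₁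
    exact eq_zero_of_continuousAt_of_forall_lt hr₁ heq.symm
      (contDiffAt_newtonNearGrad r₀ r₁ a hz0 (n := 0)).continuousAt
      fun w hw => newtonNearGrad_eq_zero_of_lt h₀.le h₁ a hw

/-- **`∂_b∂_aΓ₀(z) = 0` for `|z| ≥ r₁`.** [folklore] -/
theorem newtonNearHess_eq_zero_of_le (h₀ : 0 < r₀) (h₁ : r₀ < r₁) (a b : ℝ³) {z : ℝ³}
    (hz : r₁ ≤ ‖z‖) : newtonNearHess r₀ r₁ a b z = 0 := by
  rcases hz.lt_or_eq with hlt | heq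
  · exact newtonNearHess_eq_zero_of_lt h₀.le h₁ a b hlt
  · have hr₁ : 0 < r₁ := h₀.trans h₁
    have hz0 : z ≠ 0 := by
      rw [← norm_pos_iff, ← heq]; exact hr₁
    exact eq_zero_of_continuousAt_of_forall_lt hr₁ heq.symm
      (contDiffAt_newtonNearHess r₀ r₁ a b hz0 (n := 0)).continuousAt
      fun w hw => newtonNearHess_eq_zero_of_lt h₀.le h₁ a b hw

/-- The topological support of `∂_aΓ₀` lies in the closed ball of radius `r₁`. [folklore] -/
theorem tsupport_newtonNearGrad_subset (h₀ : 0 < r₀) (h₁ : r₀ < r₁) (a : ℝ³) :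
    tsupport (newtonNearGrad r₀ r₁ a) ⊆ closedBall (0 : ℝ³) r₁ := by
  refine closure_minimal (fun z hz => ?_) isClosed_closedBall
  rw [mem_closedBall_zero_iff]
  by_contra h
  exact hz (newtonNearGrad_eq_zero_of_lt h₀.le h₁ a (not_le.1 h))

/-- `∂_aΓ₀` has compact support. [folklore] -/
theorem hasCompactSupport_newtonNearGrad (h₀ : 0 < r₀) (h₁ : r₀ < r₁) (a : ℝ³) :
    HasCompactSupport (newtonNearGrad r₀ r₁ a) :=
  (isCompact_closedBall (0 : ℝ³) r₁).of_isClosed_subset isClosed_closure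
    (tsupport_newtonNearGrad_subset h₀ h₁ a)

/-- The topological support of `∂_b∂_aΓ₀` lies in the closed ball of radius `r₁`. [folklore] -/
theorem tsupport_newtonNearHess_subset (h₀ : 0 < r₀) (h₁ : r₀ < r₁) (a b : ℝ³) :
    tsupport (newtonNearHess r₀ r₁ a b) ⊆ closedBall (0 : ℝ³) r₁ := by
  refine closure_minimal (fun z hz => ?_) isClosed_closedBall
  rw [mem_closedBall_zero_iff]
  by_contra h
  exact hz (newtonNearHess_eq_zero_of_lt h₀.le h₁ a b (not_le.1 h))

/-- `∂_b∂_aΓ₀` has compact support. [folklore] -/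
theorem hasCompactSupport_newtonNearHess (h₀ : 0 < r₀) (h₁ : r₀ < r₁) (a b : ℝ³) :
    HasCompactSupport (newtonNearHess r₀ r₁ a b) :=
  (isCompact_closedBall (0 : ℝ³) r₁).of_isClosed_subset isClosed_closure
    (tsupport_newtonNearHess_subset h₀ h₁ a b)

/-- `∂_aΓ₀` is measurable. [folklore] -/
theorem measurable_newtonNearGrad (r₀ r₁ : ℝ) (a : ℝ³) :
    Measurable (newtonNearGrad r₀ r₁ a) :=
  measurable_fderiv_apply_const ℝ (newtonNear r₀ r₁) a

/-- `∂_b∂_aΓ₀` is measurable. [folklore] -/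
theorem measurable_newtonNearHess (r₀ r₁ : ℝ) (a b : ℝ³) :
    Measurable (newtonNearHess r₀ r₁ a b) :=
  (ContinuousLinearMap.apply ℝ ℝ a).continuous.measurable.comp
    (measurable_fderiv_apply_const ℝ (fderiv ℝ (newtonNear r₀ r₁)) b)

/-- **`∂_aΓ₀` is integrable** (`|∂_aΓ₀(z)| ≤ C₁‖a‖|z|⁻²` on the ball of radius `r₁ + 1`, zero
outside; `|z|⁻²` is integrable on balls of `ℝ³`). [folklore] -/
theorem integrable_newtonNearGrad (h₀ : 0 < r₀) (h₁ : r₀ < r₁) (a : ℝ³) :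
    Integrable (newtonNearGrad r₀ r₁ a) := by
  obtain ⟨C, hC0, hC⟩ := exists_abs_newtonNearGrad_le h₀ h₁
  have hs : (2 : ℝ) < 3 := by norm_num
  have h0 : IntegrableOn (fun z : ℝ³ => C * ‖a‖ * ‖z‖ ^ (-(2 : ℝ))) (ball 0 (r₁ + 1)) :=
    (integrableOn_ball_norm_rpow_neg hs (r₁ + 1)).const_mul (C * ‖a‖)
  have hmaj : Integrable ((ball (0 : ℝ³) (r₁ + 1)).indicator
      fun z => C * ‖a‖ * ‖z‖ ^ (-(2 : ℝ))) :=
    h0.integrable_indicator measurableSet_ball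
  refine hmaj.mono' (measurable_newtonNearGrad r₀ r₁ a).aestronglyMeasurable
    (Eventually.of_forall fun z => ?_)
  rw [Real.norm_eq_abs]
  by_cases hz : z ∈ ball (0 : ℝ³) (r₁ + 1)
  · rw [indicator_of_mem hz]
    exact hC a z
  · rw [indicator_of_notMem hz, newtonNearGrad_eq_zero_of_lt h₀.le h₁ a ?_, abs_zero]
    rw [mem_ball_zero_iff, not_lt] at hz
    linarith

end Near

end Literature.Analysis.FluidPDE
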